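import Summits.QuantumAdvantage.AdviceFreeQNC0.AffBells24ExposedSupport
import Mathlib.RingTheory.AdjoinRoot
import HarnessLib

/-!
# Sketch25L — THEOREM B′ (linear rigidity threshold) : the typed lemma chain (ROUND-24 §2.10)

(VERBATIM copy of `HOME/qa-qnc0-p1/exp25/Sketch25L.lean`, sha256 `3755b5d51b3b…`, authored by the planner seat qn-p1 g25
(statements only, farm rc 0); landed by the prover seat qn-prover-3 g14 as the typed intermediate targets of ask P-25
(Theorem B′ = `AffBells25.StrongFullSupportRigidityLin` of `AffBells25FullSupportRigidity.lean`).  Only this paragraph, the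
`HarnessLib` import and three docstrings (`suppF`, `SupportFacts`, `InteriorPointLemma`) are new.  The targets are PROVED in
the sibling files `AffBells25Omega.lean` (L1–L3), `AffBells25Euler.lean` (L4, L7), `AffBells25Covering.lean` (L5, L6) and
assembled in `AffBells25StrongRigidityLin.lean`.  WHAT THIS IS NOT: instrument for the (NP₀) rung of crux
stmt-QuantumAdvantage-22907 (route DWalkThree, `p = 3` side); no route item; separation NOT moved.)

Targets only (each `def … : Prop`), in proof order; the end statement is
`AffBells25.StrongFullSupportRigidityLin` (Sketch25.lean), whose glue to the tree's `FullSupportRigidity` is proved there.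
Ring of coefficients `R = 𝔽₂[ω]/(ω²+ω+1)` (= 𝔽₄; only `char 2`, `ω³ = 1`, and the power basis `{1, ω}` are used).

(L1) test identity      `[L = c] = 1 + ω^(L-c) + ω^(2(L-c))` in R.
(L2) orthogonality      `Σ_y ω^{-⟨δ,1-y⟩} ω^{⟨γ,y⟩} = [γ = δ]` for `γ, δ ∈ {1,2}^Z` (a product of Z two-term sums).
(L3) linearisation      XOR of full-support tests `≡ b` on `P_σ` ⇒ for every `δ ∈ {1,2}^Z`:
                        `coefA γ c δ = (K+b)·ω^{⟨δ,1⟩} + ω^{-⟨δ,1⟩}·F_S(δ)`, `S = {y ∈ P_{1-σ} : XOR(y) ≠ b}`.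
(L4) Euler recurrence   `Σ_e ω^{δ_e} F_S(δ^{(e)}) = (τ + Σ_e ω^{δ_e}) F_S(δ)` for `S ⊆ P_τ`;  antipodality `F_S(-δ) = F_S(δ)^2`.
(L5) covering lemma     (pure hypercube combinatorics) antipodal nonempty `U`, no outside vertex with exactly one `U`-neighbour,
                        `Z ≥ 5` ⇒ `#U ≥ Z + 2`.
(L6) domination count   (pure combinatorics) every point of `W ∖ U` has a neighbour in `U` ⇒ `#W ≤ (Z+1)·#U`.
(L7) assembly           lonely row ⇒ `coefA ≠ 0` somewhere ⇒ `#{δ : coefA δ ≠ 0} ≤ 2K`; β = 0: (L4)+(L5) ⇒ `2K ≥ Z+2`;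
                        β = 1: (L4) interior-point computation + (L6) ⇒ `2K·(Z+1) ≥ 2^{Z-1}`; both contradict `2K ≤ Z`, `Z ≥ 7`.
-/

namespace Summit.QuantumAdvantage.AdviceFreeQNC0

namespace AffBells25L

open Finset AffBells24 Polynomial

/-- `R = 𝔽₂[X]/(X²+X+1)`. -/
abbrev R : Type := AdjoinRoot (X ^ 2 + X + 1 : Polynomial (ZMod 2))

/-- `ω` = the class of `X`: `ω² + ω + 1 = 0`, `ω³ = 1`. -/
noncomputable def ω : R := AdjoinRoot.root (X ^ 2 + X + 1 : Polynomial (ZMod 2))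

/-- `ω^a` for `a : ZMod 3` (well defined since `ω³ = 1`). -/
noncomputable def ωpow (a : ZMod 3) : R := ω ^ a.val

/-- The character `χ_γ(y) = ω^{⟨γ,y⟩}` on the cube. -/
noncomputable def chi {Z : ℕ} (γ : Fin Z → ZMod 3) (y : Fin Z → Bool) : R :=
  ωpow (∑ e, if y e then γ e else 0)

/-- (L1) The test identity in `R`: `[L = c] = 1 + ω^{L-c} + ω^{2(L-c)}`. -/
def TestIdentity : Prop :=
  ∀ L c : ZMod 3, (if L = c then (1 : R) else 0) = 1 + ωpow (L - c) + ωpow (2 * (L - c))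

/-- Sign vectors `δ ∈ {1,2}^Z`. -/
def IsSign {Z : ℕ} (δ : Fin Z → ZMod 3) : Prop := ∀ e, δ e ≠ 0

/-- The dual kernel `k(δ,y) = ω^{-⟨δ, 1-y⟩}`. -/
noncomputable def dualKer {Z : ℕ} (δ : Fin Z → ZMod 3) (y : Fin Z → Bool) : R :=
  ωpow (-(∑ e, if y e then 0 else δ e))

/-- (L2) Orthogonality: `Σ_y k(δ,y) χ_γ(y) = [γ = δ]` for sign vectors. -/
def Orthogonality : Prop :=
  ∀ (Z : ℕ) (γ δ : Fin Z → ZMod 3), IsSign γ → IsSign δ →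
    (∑ y : Fin Z → Bool, dualKer δ y * chi γ y) = if γ = δ then 1 else 0

/-- The class coefficient of `δ`: `A_δ = Σ_{g : γ_g = δ} ω^{-c_g} + Σ_{g : γ_g = -δ} ω^{c_g}`. -/
noncomputable def coefA {Z K : ℕ} (γ : Fin K → Fin Z → ZMod 3) (c : Fin K → ZMod 3)
    (δ : Fin Z → ZMod 3) : R :=
  (∑ g ∈ univ.filter (fun g => γ g = δ), ωpow (-c g)) + ∑ g ∈ univ.filter (fun g => γ g = -δ), ωpow (c g)

/-- `F_S(δ) = Σ_{y ∈ S} ω^{⟨δ,y⟩}`. -/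
noncomputable def FS {Z : ℕ} (S : Finset (Fin Z → Bool)) (δ : Fin Z → ZMod 3) : R :=
  ∑ y ∈ S, chi δ y

/-- `ω^{⟨δ,1⟩}`. -/
noncomputable def piOne {Z : ℕ} (δ : Fin Z → ZMod 3) : R := ωpow (∑ e, δ e)

/-- The exceptional set `S = {y ∈ P_{1-σ} : XOR(y) ≠ b}`. -/
def excS {Z K : ℕ} (γ : Fin K → Fin Z → ZMod 3) (c : Fin K → ZMod 3) (σ : ℕ) (b : Bool) :
    Finset (Fin Z → Bool) :=
  (parityClass Z (σ + 1)).filter fun y => xorTests γ c y ≠ b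

/-- (L3) Linearisation: an XOR of full-support tests constant `= b` on `P_σ` forces, for every sign vector `δ`,
`A_δ = (K + b)·ω^{⟨δ,1⟩} + ω^{-⟨δ,1⟩} F_S(δ)`. -/
def Linearisation : Prop :=
  ∀ (Z K σ : ℕ) (γ : Fin K → Fin Z → ZMod 3) (c : Fin K → ZMod 3) (b : Bool),
    (∀ g e, γ g e ≠ 0) → (∀ y ∈ parityClass Z σ, xorTests γ c y = b) →
    ∀ δ : Fin Z → ZMod 3, IsSign δ →
      coefA γ c δ = ((K : R) + (if b then 1 else 0)) * piOne δ + ωpow (-(∑ e, δ e)) * FS (excS γ c σ b) δ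

/-- Sign flip at coordinate `e`. -/
def flipAt {Z : ℕ} (e : Fin Z) (δ : Fin Z → ZMod 3) : Fin Z → ZMod 3 :=
  Function.update δ e (-δ e)

/-- (L4a) Euler recurrence for `S ⊆ P_τ`: `Σ_e ω^{δ_e} F_S(δ^{(e)}) = (τ + Σ_e ω^{δ_e}) F_S(δ)`. -/
def EulerRecurrence : Prop :=
  ∀ (Z τ : ℕ) (S : Finset (Fin Z → Bool)), S ⊆ parityClass Z τ → ∀ δ : Fin Z → ZMod 3, IsSign δ →
    (∑ e, ωpow (δ e) * FS S (flipAt e δ)) = ((τ : R) + ∑ e, ωpow (δ e)) * FS S δ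

/-- (L4b) Antipodality (Frobenius): `F_S(-δ) = F_S(δ)²`. -/
def Antipodality : Prop :=
  ∀ (Z : ℕ) (S : Finset (Fin Z → Bool)) (δ : Fin Z → ZMod 3), FS S (-δ) = FS S δ ^ 2

/-- Cube neighbours: flip one Boolean coordinate. -/
def nbr {Z : ℕ} (e : Fin Z) (u : Fin Z → Bool) : Fin Z → Bool := Function.update u e (!u e)

/-- (L5) COVERING LEMMA (pure combinatorics on `Fin Z → Bool`): `Z ≥ 5`, `U` nonempty, closed under complement, and no
vertex outside `U` has exactly one neighbour in `U` ⇒ `#U ≥ Z + 2`. -/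
def CoveringLemma : Prop :=
  ∀ (Z : ℕ) (U : Finset (Fin Z → Bool)), 5 ≤ Z → U.Nonempty → (∀ u ∈ U, (fun e => !u e) ∈ U) →
    (∀ v ∉ U, (univ.filter fun e => nbr e v ∈ U).card ≠ 1) → Z + 2 ≤ U.card

/-- (L6) DOMINATION COUNT: if every point of `W ∖ U` has a neighbour in `U` then `#W ≤ (Z+1)·#U`. -/
def DominationCount : Prop :=
  ∀ (Z : ℕ) (U W : Finset (Fin Z → Bool)), (∀ w ∈ W, w ∉ U → ∃ e, nbr e w ∈ U) → W.card ≤ (Z + 1) * U.card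

/-- (L7a) β = 0 support facts: for `S ⊆ P_τ` nonempty... stated on the SIGN cube via `y ↦ δ(y)`, `δ_e = if y_e then 2 else 1`:
the support `U = {y : F_S(δ(y)) ≠ 0}` is closed under complement and has no outside vertex with exactly one `U`-neighbour. -/
noncomputable def signOf {Z : ℕ} (y : Fin Z → Bool) : Fin Z → ZMod 3 := fun e => if y e then 2 else 1

open Classical in
/-- The support `U = {y : F_S(δ(y)) ≠ 0}` of `F_S` on the sign cube, indexed by Boolean vectors via `signOf`. -/
noncomputable def suppF {Z : ℕ} (S : Finset (Fin Z → Bool)) : Finset (Fin Z → Bool) :=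
  univ.filter fun y => FS S (signOf y) ≠ 0

/-- (L7a) β = 0 support facts: for `S ⊆ P_τ`, `suppF S` is closed under complement and no vertex outside it has exactly
one neighbour inside (from the Euler recurrence at a zero and antipodality). -/
def SupportFacts : Prop :=
  ∀ (Z τ : ℕ) (S : Finset (Fin Z → Bool)), S ⊆ parityClass Z τ →
    (∀ u ∈ suppF S, (fun e => !u e) ∈ suppF S) ∧
    (∀ v ∉ suppF S, (univ.filter fun e => nbr e v ∈ suppF S).card ≠ 1)

open Classical in
/-- (L7b) β = 1 interior-point lemma: with `U₁ = {y : F_S(δ(y)) ≠ ω^{2⟨δ(y),1⟩}}`, a point outside `U₁` all of whose neighbours are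
outside `U₁` has `Z` even and `[#{e : y_e = false} odd] = τ`; hence (Z odd) every outside point has a `U₁`-neighbour, and (Z even)
every outside point of the other half does. -/
noncomputable def suppF1 {Z : ℕ} (S : Finset (Fin Z → Bool)) : Finset (Fin Z → Bool) :=
  univ.filter fun y => FS S (signOf y) ≠ ωpow (2 * ∑ e, signOf y e)

/-- (L7b) INTERIOR-POINT LEMMA: for `S ⊆ P_τ`, a point outside `suppF1 S` all of whose neighbours are outside has `Z` even
and `#{e : y_e = false} ≡ τ (mod 2)` (the Euler recurrence there reads `Z = τ + n₁ω + n₂ω²` in `R`). -/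
def InteriorPointLemma : Prop :=
  ∀ (Z τ : ℕ) (S : Finset (Fin Z → Bool)), S ⊆ parityClass Z τ →
    ∀ y ∉ suppF1 S, (∀ e, nbr e y ∉ suppF1 S) →
      Z % 2 = 0 ∧ (univ.filter fun e => y e = false).card % 2 = τ % 2

/-! The end statement is `AffBells25.StrongFullSupportRigidityLin` (Sketch25.lean); (L1)–(L7) ⇒ it, by the counting in §2.10. -/

example : TestIdentity → Orthogonality → Linearisation → EulerRecurrence → Antipodality → CoveringLemma →
    DominationCount → SupportFacts → InteriorPointLemma → True := fun _ _ _ _ _ _ _ _ _ => trivial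

end AffBells25L

end Summit.QuantumAdvantage.AdviceFreeQNC0
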